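import Mathlib
import HarnessLib
import Summits.Ventures.LatticeQCDFlow.Scaling.U1TorusIdentityFlowGeometricLaw
import Summits.Ventures.LatticeQCDFlow.Scaling.IMHHoldingTimeESS

/-!
# LatticeQCDFlow / Scaling — the equilibrium HOLDING TIME of the untrained U(1) Wilson sampler on any
# finite complex and on the torus: `E_π[1/a] ∈ [1/ESS, 2/ESS]` with
# `1/ESS = (2π)^{#links} Z(2β)/Z(β)²` (complex) `= Σₖ I_{|k|}(2β)^V/(Σₖ I_{|k|}(β)^V)²` (torus),
# itself within `[(I₀(2β)/I₀(β)²)^V·I₀(β)²e^{−2β}, (I₀(2β)/I₀(β)²)^V·e^{2β}/I₀(2β)]`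

HONEST FRAMING: exact (Metropolis-corrected) sampling algorithms for lattice gauge theory;
figures of merit are autocorrelation/cost numbers at stated couplings and volumes; no
continuum-physics claim.

Venture `LatticeQCDFlow` (cell pub-lqcd), topic `Scaling`; FANOUT row 3 (`s0-u1-a`, S0-B
implementation A: the 2-d U(1) flow sampler, GEN-13).  NEW WORK of the cell (closed forms, no
numerics): the periodic-torus companion of row 3's `Scaling/U1IdentityFlowHoldingTime` (GEN-12,
factorised plaquettes).  Row 2's general-space holding-time law (`Scaling/IMHHoldingTimeESS`, imported:
`∫ w/(1 − λ(w/q)) dμ ∈ [W₂/Z, 2W₂/Z]`, `λ = rejCurve`) is instantiated on row 5's torus box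
(`Scoring/SchwingerDysonLattice`: `n + 1` links on `(0,2π]^{n+1}`, Wilson weight `W_β`, `Z(β) = u1WilsonZ`)
with `w = W_β`, `q = (2π)^{−(n+1)}`, `W₂ = (2π)^{n+1} Z(2β)` (row 3's `U1WilsonIdentityFlowLaw`,
`W_β² = W_{2β}`), and compared with the factorised model through the sector-sum sandwich of row 3's
`U1TorusIdentityFlowGeometricLaw` (imported):

* `u1Wilson_weightMoment_eq` — `∫ (W_β/q)·W_β = (2π)^{n+1} Z(2β)`;
* **`u1WilsonIdentityFlow_holdingTime_mem_Icc`** — on any finite complex, the equilibrium mean holding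
  time `E_π[1/a] = (1/Z(β)) ∫ W_β/(1 − λ(W_β/q))` of the exact untrained chain lies in
  `[(2π)^{n+1}Z(2β)/Z(β)², 2·(2π)^{n+1}Z(2β)/Z(β)²] = [1/ESS, 2/ESS]`;
* **`u1TorusIdentityFlow_holdingTime_mem_Icc`** — on the `L₁ × L₂` torus at uniform coupling,
  `E_π[1/a] ∈ [Σₖ I_{|k|}(2β)^V/(Σₖ I_{|k|}(β)^V)², 2·Σₖ I_{|k|}(2β)^V/(Σₖ I_{|k|}(β)^V)²]` (`V = L₁L₂`);
* **`u1TorusIdentityFlow_holdingTime_geometric`** — for `β > 0`,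
  `(I₀(2β)/I₀(β)²)^V · I₀(β)² e^{−2β} ≤ E_π[1/a] ≤ 2·(I₀(2β)/I₀(β)²)^V · e^{2β}/I₀(2β)`: the expected
  wait of the untrained torus chain grows geometrically in the number of plaquettes at the factorised
  rate `log(I₀(2β)/I₀(β)²) > 0` (`β ≠ 0`), up to volume-independent factors.

Reading (value-free; no number of ours is computed or implied): started in equilibrium, the untrained
exact sampler of the periodic 2-d U(1) model waits on average `1/ESS` to `2/ESS` proposals before moving,
exactly as for the factorised model with the sector sums in place of `I₀^V`.  NOT CLAIMED: any value at
the cell's `(β, L)`; nothing re-scored, SEALED.md untouched.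
-/

noncomputable section

namespace Summit.Ventures.LatticeQCDFlow.Theory2

open MeasureTheory Real Set Finset
open Literature.Analysis.FunctionSpaces (besselI)
open Summit.Ventures.LatticeQCDFlow.Scoring
open Summit.Ventures.LatticeQCDFlow.Exactness (rejCurve)

/-! ## §1 Any finite complex -/

section General

variable {n : ℕ} {ι : Type*} (Ps : Finset ι) (inc : ι → Fin (n + 1) → ℤ) (βp : ι → ℝ)

/-- Pointwise: `(W_β/q)·W_β = (2π)^{n+1} W_{2β}`. [folklore] -/
theorem u1Wilson_weightMoment_integrand (θ : Fin (n + 1) → ℝ) :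
    u1WilsonWeight Ps inc βp θ / (1 / (2 * π) ^ (n + 1)) * u1WilsonWeight Ps inc βp θ
      = (2 * π) ^ (n + 1) * u1WilsonWeight Ps inc (fun p => 2 * βp p) θ := by
  rw [← u1WilsonWeight_sq]
  field_simp

/-- `(W_β/q)·W_β` is integrable on the torus box. [folklore] -/
theorem u1Wilson_weightMoment_integrable :
    Integrable (fun θ => u1WilsonWeight Ps inc βp θ / (1 / (2 * π) ^ (n + 1))
      * u1WilsonWeight Ps inc βp θ) (volume.restrict (u1TorusBox (n + 1))) := by
  simp_rw [u1Wilson_weightMoment_integrand]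
  exact (integrable_u1WilsonWeight Ps inc _).const_mul _

/-- **`W₂ = ∫ (W_β/q)·W_β = (2π)^{n+1} Z(2β)`.** [ours] -/
theorem u1Wilson_weightMoment_eq :
    ∫ θ in u1TorusBox (n + 1), u1WilsonWeight Ps inc βp θ / (1 / (2 * π) ^ (n + 1))
        * u1WilsonWeight Ps inc βp θ
      = (2 * π) ^ (n + 1) * u1WilsonZ Ps inc (fun p => 2 * βp p) := by
  simp_rw [u1Wilson_weightMoment_integrand]
  rw [integral_const_mul, ← u1WilsonZ]

/-- **THE HOLDING TIME OF THE UNTRAINED CHAIN (unnormalised form)**: row 2's law on the torus box,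
`∫ W_β/(1 − λ(W_β/q)) ∈ [(2π)^{n+1}Z(2β)/Z(β), 2·(2π)^{n+1}Z(2β)/Z(β)]`. [ours] -/
theorem u1WilsonIdentityFlow_holdingIntegral_mem_Icc :
    ∫ θ in u1TorusBox (n + 1), u1WilsonWeight Ps inc βp θ
        / (1 - rejCurve (volume.restrict (u1TorusBox (n + 1))) (u1WilsonWeight Ps inc βp)
            (fun _ => (1 / (2 * π) ^ (n + 1) : ℝ))
            (u1WilsonWeight Ps inc βp θ / (1 / (2 * π) ^ (n + 1))))
      ∈ Set.Icc ((2 * π) ^ (n + 1) * u1WilsonZ Ps inc (fun p => 2 * βp p) / u1WilsonZ Ps inc βp)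
          (2 * ((2 * π) ^ (n + 1) * u1WilsonZ Ps inc (fun p => 2 * βp p)) / u1WilsonZ Ps inc βp) := by
  have hqi : Integrable (fun _ : Fin (n + 1) → ℝ => (1 / (2 * π) ^ (n + 1) : ℝ))
      (volume.restrict (u1TorusBox (n + 1))) := by
    haveI := isFiniteMeasure_volume_restrict_u1TorusBox (n + 1)
    exact integrable_const _
  have h := holdingTime_mem_Icc (μ := volume.restrict (u1TorusBox (n + 1)))
    (u1WilsonWeight_pos Ps inc βp) (continuous_u1WilsonWeight Ps inc βp).measurable
    (integrable_u1WilsonWeight Ps inc βp) (fun _ => by positivity) measurable_const hqi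
    integral_u1HaarD (u1Wilson_weightMoment_integrable Ps inc βp)
  have hZdef : ∫ z, u1WilsonWeight Ps inc βp z ∂(volume.restrict (u1TorusBox (n + 1)))
      = u1WilsonZ Ps inc βp := by rw [← u1WilsonZ]
  rw [hZdef, u1Wilson_weightMoment_eq] at h
  exact h

/-- **THE EQUILIBRIUM MEAN HOLDING TIME `E_π[1/a] ∈ [1/ESS, 2/ESS]`** on any finite complex:
`(1/Z(β)) ∫ W_β/(1 − λ(W_β/q)) ∈ [(2π)^{n+1}Z(2β)/Z(β)², 2·(2π)^{n+1}Z(2β)/Z(β)²]`, the reciprocal of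
row 3's `ESS = Z(β)²/((2π)^{n+1}Z(2β))` up to a factor `2`. [ours] -/
theorem u1WilsonIdentityFlow_holdingTime_mem_Icc :
    (∫ θ in u1TorusBox (n + 1), u1WilsonWeight Ps inc βp θ
        / (1 - rejCurve (volume.restrict (u1TorusBox (n + 1))) (u1WilsonWeight Ps inc βp)
            (fun _ => (1 / (2 * π) ^ (n + 1) : ℝ))
            (u1WilsonWeight Ps inc βp θ / (1 / (2 * π) ^ (n + 1)))))
        / u1WilsonZ Ps inc βp
      ∈ Set.Icc ((2 * π) ^ (n + 1) * u1WilsonZ Ps inc (fun p => 2 * βp p) / u1WilsonZ Ps inc βp ^ 2)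
          (2 * ((2 * π) ^ (n + 1) * u1WilsonZ Ps inc (fun p => 2 * βp p)) / u1WilsonZ Ps inc βp ^ 2) := by
  have hZ := u1WilsonZ_pos Ps inc βp
  obtain ⟨h1, h2⟩ := u1WilsonIdentityFlow_holdingIntegral_mem_Icc Ps inc βp
  constructor
  · rw [sq, ← div_div]
    exact div_le_div_of_nonneg_right h1 hZ.le
  · rw [sq, ← div_div]
    exact div_le_div_of_nonneg_right h2 hZ.le

end General

/-! ## §2 The periodic `L₁ × L₂` torus -/

section Torus

variable {L₁ L₂ : ℕ} [NeZero L₁] [NeZero L₂] {n : ℕ}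
  (e : Fin 2 × (Fin L₁ × Fin L₂) ≃ Fin (n + 1)) {β : ℝ}

/-- Algebra: `c·(c·B)/(c·A)² = B/A²`. [folklore] -/
theorem torus_holding_cancel {c A B : ℝ} (hc : c ≠ 0) : c * (c * B) / (c * A) ^ 2 = B / A ^ 2 := by
  rw [mul_pow, ← mul_assoc, ← sq, mul_div_mul_left _ _ (pow_ne_zero 2 hc)]

/-- **HOLDING TIME ON THE TORUS**: `E_π[1/a] ∈ [S_V(2β)/S_V(β)², 2·S_V(2β)/S_V(β)²]` with the sector sums
`S_V(γ) = Σₖ I_{|k|}(γ)^V`, `V = L₁L₂` (every real `β`). [ours] -/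
theorem u1TorusIdentityFlow_holdingTime_mem_Icc (β : ℝ) :
    (∫ θ in u1TorusBox (n + 1), u1WilsonWeight univ (torusInc e) (fun _ => β) θ
        / (1 - rejCurve (volume.restrict (u1TorusBox (n + 1)))
            (u1WilsonWeight univ (torusInc e) (fun _ => β)) (fun _ => (1 / (2 * π) ^ (n + 1) : ℝ))
            (u1WilsonWeight univ (torusInc e) (fun _ => β) θ / (1 / (2 * π) ^ (n + 1)))))
        / u1WilsonZ univ (torusInc e) (fun _ => β)
      ∈ Set.Icc ((∑' k : ℤ, besselI k.natAbs (2 * β) ^ (L₁ * L₂))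
            / (∑' k : ℤ, besselI k.natAbs β ^ (L₁ * L₂)) ^ 2)
          (2 * ((∑' k : ℤ, besselI k.natAbs (2 * β) ^ (L₁ * L₂))
            / (∑' k : ℤ, besselI k.natAbs β ^ (L₁ * L₂)) ^ 2)) := by
  have hc : (2 * π : ℝ) ^ (n + 1) ≠ 0 := by positivity
  obtain ⟨h1, h2⟩ := u1WilsonIdentityFlow_holdingTime_mem_Icc univ (torusInc e) (fun _ => β)
  constructor
  · calc (∑' k : ℤ, besselI k.natAbs (2 * β) ^ (L₁ * L₂))
            / (∑' k : ℤ, besselI k.natAbs β ^ (L₁ * L₂)) ^ 2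
        = (2 * π) ^ (n + 1) * u1WilsonZ univ (torusInc e) (fun _ => 2 * β)
            / u1WilsonZ univ (torusInc e) (fun _ => β) ^ 2 := by
          rw [torus_u1WilsonZ_uniform e β, torus_u1WilsonZ_uniform e (2 * β), torus_holding_cancel hc]
      _ ≤ _ := h1
  · calc _ ≤ 2 * ((2 * π) ^ (n + 1) * u1WilsonZ univ (torusInc e) (fun _ => 2 * β))
            / u1WilsonZ univ (torusInc e) (fun _ => β) ^ 2 := h2
      _ = 2 * ((∑' k : ℤ, besselI k.natAbs (2 * β) ^ (L₁ * L₂))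
            / (∑' k : ℤ, besselI k.natAbs β ^ (L₁ * L₂)) ^ 2) := by
          rw [torus_u1WilsonZ_uniform e β, torus_u1WilsonZ_uniform e (2 * β), mul_div_assoc,
            torus_holding_cancel hc]

/-- **GEOMETRIC GROWTH OF THE HOLDING TIME ON THE TORUS** (`β > 0`, `V = L₁L₂`):
`(I₀(2β)/I₀(β)²)^V · I₀(β)²e^{−2β} ≤ E_π[1/a] ≤ 2·(I₀(2β)/I₀(β)²)^V · e^{2β}/I₀(2β)`. [ours] -/
theorem u1TorusIdentityFlow_holdingTime_geometric (hβ : 0 < β) :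
    (∫ θ in u1TorusBox (n + 1), u1WilsonWeight univ (torusInc e) (fun _ => β) θ
        / (1 - rejCurve (volume.restrict (u1TorusBox (n + 1)))
            (u1WilsonWeight univ (torusInc e) (fun _ => β)) (fun _ => (1 / (2 * π) ^ (n + 1) : ℝ))
            (u1WilsonWeight univ (torusInc e) (fun _ => β) θ / (1 / (2 * π) ^ (n + 1)))))
        / u1WilsonZ univ (torusInc e) (fun _ => β)
      ∈ Set.Icc ((besselI 0 (2 * β) / besselI 0 β ^ 2) ^ (L₁ * L₂)
            * (besselI 0 β ^ 2 / Real.exp β ^ 2))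
          (2 * ((besselI 0 (2 * β) / besselI 0 β ^ 2) ^ (L₁ * L₂)
            * (Real.exp (2 * β) / besselI 0 (2 * β)))) := by
  have hV : 1 ≤ L₁ * L₂ := one_le_torusVolume
  have h2β : 0 < 2 * β := by linarith
  have hI := besselI_pos 0 hβ
  have hI2 := besselI_pos 0 h2β
  obtain ⟨h1, h2⟩ := u1TorusIdentityFlow_holdingTime_mem_Icc e β
  obtain ⟨W, hW⟩ := Nat.exists_eq_add_of_le' hV
  -- sector-sum sandwich for `S(β)` and `S(2β)`
  have hSlo := besselI_zero_pow_le_torusSum hβ hV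
  have hShi := torusSum_le hβ hV
  have hS2lo := besselI_zero_pow_le_torusSum h2β hV
  have hS2hi := torusSum_le h2β hV
  have hS := torusSum_pos hβ hV
  rw [hW] at hSlo hShi hS2lo hS2hi hS h1 h2 ⊢
  rw [show W + 1 - 1 = W from rfl] at hShi hS2hi
  constructor
  · -- lower: `S(2β)/S(β)² ≥ I₀(2β)^{W+1}/(I₀(β)^W e^β)²`
    refine le_trans ?_ h1
    have hlo : besselI 0 (2 * β) ^ (W + 1) / (besselI 0 β ^ W * Real.exp β) ^ 2
        ≤ (∑' k : ℤ, besselI k.natAbs (2 * β) ^ (W + 1))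
          / (∑' k : ℤ, besselI k.natAbs β ^ (W + 1)) ^ 2 :=
      div_le_div₀ (tsum_nonneg fun k => pow_nonneg (besselI_pos _ h2β).le _) hS2lo
        (pow_pos hS 2) (pow_le_pow_left₀ hS.le hShi 2)
    refine le_trans (le_of_eq ?_) hlo
    have key : besselI 0 (2 * β) ^ (W + 1) / (besselI 0 β ^ W * Real.exp β) ^ 2
        = ((besselI 0 β ^ W * Real.exp β) ^ 2 / besselI 0 (2 * β) ^ (W + 1))⁻¹ := (inv_div _ _).symm
    rw [key, geometric_upper_eq hI.ne' hI2.ne' W, mul_inv, ← inv_pow, inv_div, inv_div]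
  · -- upper: `S(2β)/S(β)² ≤ I₀(2β)^W e^{2β}/I₀(β)^{2(W+1)}`
    refine le_trans h2 ?_
    have hhi : (∑' k : ℤ, besselI k.natAbs (2 * β) ^ (W + 1))
          / (∑' k : ℤ, besselI k.natAbs β ^ (W + 1)) ^ 2
        ≤ besselI 0 (2 * β) ^ W * Real.exp (2 * β) / (besselI 0 β ^ (W + 1)) ^ 2 :=
      div_le_div₀ (by positivity) hS2hi (pow_pos (pow_pos hI _) 2) (pow_le_pow_left₀ (pow_pos hI _).le hSlo 2)
    refine le_trans (mul_le_mul_of_nonneg_left hhi (by norm_num)) (le_of_eq ?_)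
    have key : besselI 0 (2 * β) ^ W * Real.exp (2 * β) / (besselI 0 β ^ (W + 1)) ^ 2
        = ((besselI 0 β ^ (W + 1)) ^ 2 / (besselI 0 (2 * β) ^ W * Real.exp (2 * β)))⁻¹ :=
      (inv_div _ _).symm
    rw [key, geometric_lower_eq hI2.ne' (Real.exp_pos _).ne' W, mul_inv, ← inv_pow, inv_div, inv_div]

end Torus

end Summit.Ventures.LatticeQCDFlow.Theory2

end
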